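import Mathlib
import HarnessLib
import Literature.Analysis.FluidPDE.SelfSimilar

/-!
# Route `QuarterLogPincer`, crux `TypeIQuantSubcubicExp` (stmt-NavierStokesRegularity-24077), line `truncation_edge` — stub T3
# `stub_envelopeCubeBudget` DISCHARGED (unfolded form): the cube budget of the Type-I envelope

Line `Cruxes/TypeIQuantSubcubicExp/Lines/truncation_edge.lean` (ns-idea-7 g8, v1.1 dca6249ee423; idea-crit-4 PASS 18:45Z 2026-08-28;
DIRECTOR-NS dss_105 (2): «T3/T4 open to the first idle prover hand») registers the shape
`StubEnvelopeCubeBudget : ∀ A v, 0 ≤ A → HasTypeIDecay A v → EnvelopeCubeBudget v` with the line object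

  `EnvelopeCubeBudget v := ∃ B ≥ 0, ∀ R ≥ 2, ∀ ε ∈ (0,1], ∃ b ≥ 0, b³ ≤ B·(1 + log R + log(1/ε)) ∧
     ∀ s ∈ [−1, −ε], ‖𝟙_{B(R)} v(s)‖_{L³} ≤ b`.

The line objects live in the Cruxes work-file (not importable here), so this module proves the stub with its conclusion UNFOLDED
verbatim (`envelopeCubeBudget_of_hasTypeIDecay`); once the line's `…TruncationEdgeDefs` module lands, `stub_envelopeCubeBudget` is the
one-line by-name discharge `fun A v hA hv => envelopeCubeBudget_of_hasTypeIDecay A v hA hv` (definitional unfolding).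

PROOF (Barker–Prange 2021 Cor. 1's upper bound, in the crude form the line needs): with `a = √(−s) ∈ [√ε, 1]` and the envelope
`‖v(s,x)‖ ≤ A/(‖x‖ + a)`, `∫_{B(R)} ‖v(s)‖³ ≤ ∫_{B(R)} A³/(‖x‖+a)³ dx = 4π ∫₀ᴿ r² A³/(r+a)³ dr ≤ 4πA³ ∫₀ᴿ dr/(r+a) = 4πA³ log((R+a)/a)`
(radial reduction `MeasureTheory.Measure.integral_fun_norm_addHaar`, `volume B₁ = 4π/3`, `r² ≤ (r+a)²`), and
`log((R+a)/a) ≤ log 2 + log R + ½ log(1/ε) ≤ 1 + log R + log(1/ε)`; so `B := 4πA³`, `b := (4πA³(1 + log R + log(1/ε)))^{1/3}`.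

HONEST FRAMING: calculus for a hypothetical Type-I enveloped object (an EDGE/calibration piece of the line); crux 24077, item 22144 and
Navier–Stokes regularity are OPEN and untouched. [folklore; cf. Barker–Prange 2021 (arXiv:2003.06717) Cor. 1, upper bound]
-/

noncomputable section

set_option linter.dupNamespace false

namespace Summit.NavierStokesRegularity.NavierStokesRegularity.Theorems.QuarterLogPincerTruncationEdge

open MeasureTheory MeasureTheory.Measure Set Real Metric Filter
open scoped ENNReal NNReal Topology
open Literature.Analysis.FluidPDE

/-! ## The one-dimensional budget `∫₀ᴿ r²/(r+a)³ dr ≤ log((R+a)/a)` -/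

/-- `∫₀ᴿ dr/(r + a) = log(R + a) − log a` for `a > 0`, `R ≥ 0`. [folklore] -/
theorem intervalIntegral_inv_add (a R : ℝ) (ha : 0 < a) (hR : 0 ≤ R) :
    ∫ r in (0 : ℝ)..R, (r + a)⁻¹ = Real.log (R + a) - Real.log a := by
  rw [intervalIntegral.integral_comp_add_right (fun x : ℝ => x⁻¹) a, zero_add,
    integral_inv_of_pos ha (by linarith), Real.log_div (by linarith) ha.ne']

/-- The radial cube integrand is dominated by `A³/(r + a)`: `r² (A/(r+a))³ ≤ A³ (r+a)⁻¹` for `r ≥ 0`, `a > 0`, `A ≥ 0`. [folklore] -/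
theorem sq_mul_cube_div_le {A a r : ℝ} (hA : 0 ≤ A) (ha : 0 < a) (hr : 0 ≤ r) :
    r ^ 2 * (A / (r + a)) ^ 3 ≤ A ^ 3 * (r + a)⁻¹ := by
  have hra : 0 < r + a := by linarith
  rw [div_pow, ← div_eq_mul_inv, mul_div_assoc', div_le_div_iff₀ (pow_pos hra 3) hra]
  have h1 : r ^ 2 ≤ (r + a) ^ 2 := pow_le_pow_left₀ hr (by linarith) 2
  have hA3 : 0 ≤ A ^ 3 := pow_nonneg hA 3
  nlinarith [mul_le_mul_of_nonneg_left h1 hA3, pow_pos hra 2]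

/-- **Radial budget**: `∫_{(0,∞)} r² · 𝟙_{r<R} (A/(r+a))³ dr ≤ A³ (log(R+a) − log a)` (`a > 0`, `R ≥ 0`, `A ≥ 0`). [folklore] -/
theorem setIntegral_Ioi_sq_mul_indicator_cube_le {A a R : ℝ} (hA : 0 ≤ A) (ha : 0 < a) (hR : 0 ≤ R) :
    ∫ r in Ioi (0 : ℝ), r ^ (3 - 1) • (Iio R).indicator (fun r => (A / (r + a)) ^ 3) r ≤
      A ^ 3 * (Real.log (R + a) - Real.log a) := by
  -- move the indicator outside and restrict to `(0, R)`
  have hfun : (fun r : ℝ => r ^ (3 - 1) • (Iio R).indicator (fun r => (A / (r + a)) ^ 3) r) =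
      (Iio R).indicator (fun r => r ^ 2 * (A / (r + a)) ^ 3) := by
    funext r
    by_cases hr : r ∈ Iio R
    · simp [indicator_of_mem hr]
    · simp [indicator_of_notMem hr]
  rw [hfun, integral_indicator measurableSet_Iio, Measure.restrict_restrict measurableSet_Iio,
    Iio_inter_Ioi]
  -- continuity / integrability on `[0, R]`
  have hcont : ∀ {g : ℝ → ℝ}, ContinuousOn g (Icc 0 R) → IntegrableOn g (Ioo 0 R) := fun hg =>
    (hg.integrableOn_compact isCompact_Icc).mono_set Ioo_subset_Icc_self
  have hden : ∀ r ∈ Icc (0 : ℝ) R, r + a ≠ 0 := fun r hr => by have := hr.1; positivity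
  have hc1 : ContinuousOn (fun r : ℝ => r ^ 2 * (A / (r + a)) ^ 3) (Icc 0 R) :=
    (continuousOn_id.pow 2).mul ((continuousOn_const.div (continuousOn_id.add continuousOn_const) hden).pow 3)
  have hc2 : ContinuousOn (fun r : ℝ => A ^ 3 * (r + a)⁻¹) (Icc 0 R) :=
    continuousOn_const.mul ((continuousOn_id.add continuousOn_const).inv₀ hden)
  calc ∫ r in Ioo 0 R, r ^ 2 * (A / (r + a)) ^ 3
      ≤ ∫ r in Ioo 0 R, A ^ 3 * (r + a)⁻¹ :=
        setIntegral_mono_on (hcont hc1) (hcont hc2) measurableSet_Ioo fun r hr =>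
          sq_mul_cube_div_le hA ha hr.1.le
    _ = A ^ 3 * (Real.log (R + a) - Real.log a) := by
        rw [← intervalIntegral_inv_add a R ha hR, intervalIntegral.integral_of_le hR, integral_Ioc_eq_integral_Ioo,
          integral_const_mul]

/-! ## The three-dimensional budget -/

/-- **Envelope cube integral on a ball**: for `a > 0`, `R ≥ 0`, `A ≥ 0`,
`∫ 𝟙_{B(R)}(x) (A/(‖x‖+a))³ dx ≤ 4πA³ (log(R+a) − log a)` (polar coordinates on `ℝ³`, `|B₁| = 4π/3`). [folklore] -/
theorem integral_indicator_ball_cube_le {A a R : ℝ} (hA : 0 ≤ A) (ha : 0 < a) (hR : 0 ≤ R) :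
    ∫ x : (EuclideanSpace ℝ (Fin 3)), (ball (0 : (EuclideanSpace ℝ (Fin 3))) R).indicator (fun x => (A / (‖x‖ + a)) ^ 3) x ≤
      4 * π * A ^ 3 * (Real.log (R + a) - Real.log a) := by
  have hfun : (ball (0 : (EuclideanSpace ℝ (Fin 3))) R).indicator (fun x : (EuclideanSpace ℝ (Fin 3)) => (A / (‖x‖ + a)) ^ 3) =
      fun x : (EuclideanSpace ℝ (Fin 3)) => (Iio R).indicator (fun r => (A / (r + a)) ^ 3) ‖x‖ := by
    funext x
    by_cases hx : x ∈ ball (0 : (EuclideanSpace ℝ (Fin 3))) R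
    · have hx' : ‖x‖ ∈ Iio R := by simpa using hx
      rw [indicator_of_mem hx, indicator_of_mem hx']
    · have hx' : ‖x‖ ∉ Iio R := by simpa using hx
      rw [indicator_of_notMem hx, indicator_of_notMem hx']
  rw [hfun, integral_fun_norm_addHaar (volume : Measure (EuclideanSpace ℝ (Fin 3))) ((Iio R).indicator (fun r => (A / (r + a)) ^ 3)),
    finrank_euclideanSpace_fin, measureReal_def, EuclideanSpace.volume_ball_fin_three, nsmul_eq_mul, smul_eq_mul]
  have hvol : (ENNReal.ofReal (1 : ℝ) ^ 3 * ENNReal.ofReal (π * 4 / 3)).toReal = π * 4 / 3 := by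
    rw [ENNReal.ofReal_one, one_pow, one_mul, ENNReal.toReal_ofReal (by positivity)]
  rw [hvol]
  have h1 := setIntegral_Ioi_sq_mul_indicator_cube_le hA ha hR
  have hπ : (0 : ℝ) ≤ π * 4 / 3 := by positivity
  calc (3 : ℕ) * (π * 4 / 3 * ∫ r in Ioi (0 : ℝ), r ^ (3 - 1) • (Iio R).indicator (fun r => (A / (r + a)) ^ 3) r)
      ≤ (3 : ℕ) * (π * 4 / 3 * (A ^ 3 * (Real.log (R + a) - Real.log a))) := by
        gcongr
    _ = 4 * π * A ^ 3 * (Real.log (R + a) - Real.log a) := by push_cast; ring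

/-- The majorant `𝟙_{B(R)} (A/(‖x‖+a))³` is integrable (continuous on the closed ball). [folklore] -/
theorem integrable_indicator_ball_cube {A a R : ℝ} (ha : 0 < a) :
    Integrable (fun x : (EuclideanSpace ℝ (Fin 3)) => (ball (0 : (EuclideanSpace ℝ (Fin 3))) R).indicator (fun x => (A / (‖x‖ + a)) ^ 3) x) := by
  have hne : ∀ x : (EuclideanSpace ℝ (Fin 3)), ‖x‖ + a ≠ 0 := fun x => by positivity
  have hcont : Continuous fun x : (EuclideanSpace ℝ (Fin 3)) => (A / (‖x‖ + a)) ^ 3 :=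
    (continuous_const.div (continuous_norm.add continuous_const) hne).pow 3
  exact (integrable_indicator_iff measurableSet_ball).2
    ((hcont.continuousOn.integrableOn_compact (isCompact_closedBall (0 : (EuclideanSpace ℝ (Fin 3))) R)).mono_set ball_subset_closedBall)

/-- **Logarithmic bookkeeping**: for `R ≥ 2`, `0 < ε ≤ 1`, `s ∈ [−1, −ε]`, with `a = √(−s)`:
`log(R + a) − log a ≤ 1 + log R + log(1/ε)`. [folklore] -/
theorem log_add_sqrt_sub_log_sqrt_le {R ε s : ℝ} (hR : 2 ≤ R) (hε : 0 < ε) (hε1 : ε ≤ 1) (hs : s ∈ Icc (-1 : ℝ) (-ε)) :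
    Real.log (R + Real.sqrt (-s)) - Real.log (Real.sqrt (-s)) ≤ 1 + Real.log R + Real.log (1 / ε) := by
  have hs0 : 0 < -s := by linarith [hs.2]
  have ha1 : Real.sqrt (-s) ≤ 1 := Real.sqrt_le_one.mpr (by linarith [hs.1])
  have hR0 : 0 < R := by linarith
  -- `log (R + a) ≤ log (2R) = log 2 + log R ≤ 1 + log R`
  have h1 : Real.log (R + Real.sqrt (-s)) ≤ 1 + Real.log R := by
    calc Real.log (R + Real.sqrt (-s)) ≤ Real.log (2 * R) :=
          Real.log_le_log (by positivity) (by linarith)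
      _ = Real.log 2 + Real.log R := Real.log_mul two_ne_zero hR0.ne'
      _ ≤ 1 + Real.log R := by linarith [Real.log_le_sub_one_of_pos (two_pos : (0 : ℝ) < 2)]
  -- `-log a = ½ log (1/(-s)) ≤ ½ log (1/ε) ≤ log (1/ε)`
  have h2 : -Real.log (Real.sqrt (-s)) ≤ Real.log (1 / ε) := by
    rw [Real.log_sqrt hs0.le]
    have hle : Real.log (-s)⁻¹ ≤ Real.log (1 / ε) := by
      rw [one_div]
      exact Real.log_le_log (inv_pos.2 hs0) ((inv_le_inv₀ hs0 hε).2 (by linarith [hs.2]))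
    have hnn : 0 ≤ Real.log (1 / ε) := Real.log_nonneg (by rw [le_div_iff₀ hε]; linarith)
    rw [Real.log_inv] at hle
    linarith
  linarith

/-! ## T3, unfolded -/

/-- **Stub T3 `stub_envelopeCubeBudget` of line `truncation_edge` (crux 24077), conclusion unfolded verbatim**: a field with the
Type-I envelope `‖v(s,x)‖ ≤ A/(‖x‖ + √(−s))` (`HasTypeIDecay A v`, `A ≥ 0`) has the cube budget
`∃ B ≥ 0, ∀ R ≥ 2, ∀ ε ∈ (0,1], ∃ b ≥ 0, b³ ≤ B(1 + log R + log(1/ε)) ∧ ∀ s ∈ [−1,−ε], ‖𝟙_{B(R)} v(s)‖_{L³} ≤ b`, with `B = 4πA³`.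
[folklore; Barker–Prange 2021 Cor. 1 (upper bound), arXiv:2003.06717] -/
theorem envelopeCubeBudget_of_hasTypeIDecay (A : ℝ) (v : ℝ → (EuclideanSpace ℝ (Fin 3)) → (EuclideanSpace ℝ (Fin 3))) (hA : 0 ≤ A) (hv : HasTypeIDecay A v) :
    ∃ B : ℝ, 0 ≤ B ∧ ∀ R : ℝ, 2 ≤ R → ∀ ε ∈ Set.Ioc (0 : ℝ) 1, ∃ b : ℝ, 0 ≤ b ∧
      b ^ 3 ≤ B * (1 + Real.log R + Real.log (1 / ε)) ∧
      ∀ s ∈ Set.Icc (-1 : ℝ) (-ε),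
        eLpNorm ((Metric.ball (0 : (EuclideanSpace ℝ (Fin 3))) R).indicator (v s)) 3 volume ≤ ENNReal.ofReal b := by
  refine ⟨4 * π * A ^ 3, by positivity, fun R hR ε hε => ?_⟩
  set X : ℝ := 4 * π * A ^ 3 * (1 + Real.log R + Real.log (1 / ε)) with hX
  have hlogR : 0 ≤ Real.log R := Real.log_nonneg (by linarith)
  have hlogε : 0 ≤ Real.log (1 / ε) := Real.log_nonneg (by rw [le_div_iff₀ hε.1]; linarith [hε.2])
  have hX0 : 0 ≤ X := by positivity
  refine ⟨X ^ (1 / 3 : ℝ), Real.rpow_nonneg hX0 _, ?_, fun s hs => ?_⟩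
  · rw [← Real.rpow_natCast, ← Real.rpow_mul hX0]
    norm_num
  -- the slice estimate
  have hs0 : 0 < -s := by linarith [hs.2, hε.1]
  set a : ℝ := Real.sqrt (-s) with ha_def
  have ha : 0 < a := Real.sqrt_pos.2 hs0
  have hR0 : 0 ≤ R := by linarith
  -- pointwise domination of the integrand
  have hpt : ∀ x : (EuclideanSpace ℝ (Fin 3)), ‖(ball (0 : (EuclideanSpace ℝ (Fin 3))) R).indicator (v s) x‖ₑ ^ (3 : ℝ) ≤
      ENNReal.ofReal ((ball (0 : (EuclideanSpace ℝ (Fin 3))) R).indicator (fun x => (A / (‖x‖ + a)) ^ 3) x) := by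
    intro x
    by_cases hx : x ∈ ball (0 : (EuclideanSpace ℝ (Fin 3))) R
    · rw [indicator_of_mem hx, indicator_of_mem hx, ← ofReal_norm, ENNReal.ofReal_rpow_of_nonneg (norm_nonneg _) (by norm_num),
        Real.rpow_ofNat]
      exact ENNReal.ofReal_le_ofReal (pow_le_pow_left₀ (norm_nonneg _) (hv s (by linarith) x) 3)
    · rw [indicator_of_notMem hx, indicator_of_notMem hx]
      simp
  have hint := integrable_indicator_ball_cube (A := A) (R := R) ha
  have hnn : 0 ≤ᵐ[volume] fun x : (EuclideanSpace ℝ (Fin 3)) => (ball (0 : (EuclideanSpace ℝ (Fin 3))) R).indicator (fun x => (A / (‖x‖ + a)) ^ 3) x :=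
    Eventually.of_forall fun x => indicator_nonneg (fun y _ => by positivity) x
  have hlin : ∫⁻ x : (EuclideanSpace ℝ (Fin 3)), ‖(ball (0 : (EuclideanSpace ℝ (Fin 3))) R).indicator (v s) x‖ₑ ^ (3 : ℝ) ≤ ENNReal.ofReal X := by
    calc ∫⁻ x : (EuclideanSpace ℝ (Fin 3)), ‖(ball (0 : (EuclideanSpace ℝ (Fin 3))) R).indicator (v s) x‖ₑ ^ (3 : ℝ)
        ≤ ∫⁻ x : (EuclideanSpace ℝ (Fin 3)), ENNReal.ofReal ((ball (0 : (EuclideanSpace ℝ (Fin 3))) R).indicator (fun x => (A / (‖x‖ + a)) ^ 3) x) :=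
          lintegral_mono hpt
      _ = ENNReal.ofReal (∫ x : (EuclideanSpace ℝ (Fin 3)), (ball (0 : (EuclideanSpace ℝ (Fin 3))) R).indicator (fun x => (A / (‖x‖ + a)) ^ 3) x) :=
          (ofReal_integral_eq_lintegral_ofReal hint hnn).symm
      _ ≤ ENNReal.ofReal (4 * π * A ^ 3 * (Real.log (R + a) - Real.log a)) :=
          ENNReal.ofReal_le_ofReal (integral_indicator_ball_cube_le hA ha hR0)
      _ ≤ ENNReal.ofReal X := by
          refine ENNReal.ofReal_le_ofReal (mul_le_mul_of_nonneg_left ?_ (by positivity))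
          exact log_add_sqrt_sub_log_sqrt_le hR hε.1 hε.2 hs
  rw [eLpNorm_eq_lintegral_rpow_enorm_toReal (by norm_num) (by norm_num), ENNReal.toReal_ofNat,
    ← ENNReal.ofReal_rpow_of_nonneg hX0 (by norm_num)]
  exact ENNReal.rpow_le_rpow hlin (by norm_num)

end Summit.NavierStokesRegularity.NavierStokesRegularity.Theorems.QuarterLogPincerTruncationEdge

end
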